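import Mathlib
import HarnessLib
import Summits.QuantumFields.QCD.Theses.PauliWegnerSea
import Summits.QuantumFields.QCD.Theses.HeavyThresholdYMBridge

/-!
# Sketch — crux-ideate stmt-QuantumFields-9152 (GluonicCompletion), ideator 3, round 1

First-lemma sketches for idea card `certified-sea-threshold-graft`.  Nothing here is proved; the
point is that the signatures elaborate over existing declarations.
-/

namespace Summit.QuantumFields.QCD.Cruxes.GluonicCompletion.CertifiedSeaThresholdGraft

open scoped BigOperators
open MeasureTheory Filter Literature.MathematicalPhysics.QuantumFieldTheory
  Literature.MathematicalPhysics.QuantumLattice Literature.Probability.LatticeModels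

noncomputable section

/-- The phase-quenched fractional moment of the flavour-`f` quark propagator between the origin and
`v` on the torus of side `2S+1` at step `k` — VERBATIM the quantity of clause (ii) of
`WilsonMobilityGap.MobilityGap` / hypothesis of `GluonicCompletion`. -/
def fmMoment {Nf : ℕ} (reg : QCDRegularisation Nf) (m : Fin Nf → ℝ) (s : ℝ) (k S : ℕ)
    (f : Fin Nf) (v : Site 4) : ℝ :=
  (∫ U : GaugeConfig 4 (2 * S + 1) (Matrix.specialUnitaryGroup (Fin 3) ℂ),
      ‖(diracMatrix U fun fl => reg.mcrit k + reg.a k * m fl / reg.Zm k).det‖ *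
        (∑ a : Fin 3, ∑ i : Fin 4, ∑ b : Fin 3, ∑ j : Fin 4,
          ‖(diracMatrix U fun fl => reg.mcrit k + reg.a k * m fl / reg.Zm k)⁻¹
              (quarkEquiv (f, (Torus.proj (2 * S + 1) 0, a, i)))
              (quarkEquiv (f, (Torus.proj (2 * S + 1) v, b, j)))‖) ^ s
      ∂(wilsonMeasure (fundamentalRep (Fin 3)) (reg.β k))) /
    (∫ U : GaugeConfig 4 (2 * S + 1) (Matrix.specialUnitaryGroup (Fin 3) ℂ),
      ‖(diracMatrix U fun fl => reg.mcrit k + reg.a k * m fl / reg.Zm k).det‖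
      ∂(wilsonMeasure (fundamentalRep (Fin 3)) (reg.β k)))

/-- The SAME phase-quenched expectation but of the WEIGHTED SUM over all endpoints `v` of the box,
with weights `e^{δ a_k ‖v‖/2} (1+‖v‖)^{-5}` — the quantity whose boundedness is the configuration-wise
("almost-sure") face of clause (ii): `X_v(U) ≤ A(U) (1+‖v‖)^5 e^{-δ a_k‖v‖/2}` with `E_{|w|}[A] ≤ C'`. -/
def fmWeightedSum {Nf : ℕ} (reg : QCDRegularisation Nf) (m : Fin Nf → ℝ) (s δ : ℝ) (k S : ℕ)
    (f : Fin Nf) : ℝ :=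
  (∫ U : GaugeConfig 4 (2 * S + 1) (Matrix.specialUnitaryGroup (Fin 3) ℂ),
      ‖(diracMatrix U fun fl => reg.mcrit k + reg.a k * m fl / reg.Zm k).det‖ *
        ∑ v ∈ box 4 S, Real.exp (δ * (reg.a k * ‖v‖) / 2) * ((1 + ‖v‖) ^ 5)⁻¹ *
          (∑ a : Fin 3, ∑ i : Fin 4, ∑ b : Fin 3, ∑ j : Fin 4,
            ‖(diracMatrix U fun fl => reg.mcrit k + reg.a k * m fl / reg.Zm k)⁻¹
                (quarkEquiv (f, (Torus.proj (2 * S + 1) 0, a, i)))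
                (quarkEquiv (f, (Torus.proj (2 * S + 1) v, b, j)))‖) ^ s
      ∂(wilsonMeasure (fundamentalRep (Fin 3)) (reg.β k))) /
    (∫ U : GaugeConfig 4 (2 * S + 1) (Matrix.specialUnitaryGroup (Fin 3) ℂ),
      ‖(diracMatrix U fun fl => reg.mcrit k + reg.a k * m fl / reg.Zm k).det‖
      ∂(wilsonMeasure (fundamentalRep (Fin 3)) (reg.β k)))

/-- Clause (ii) of the hypothesis of `GluonicCompletion` with its constants exposed. -/
def ClauseII {Nf : ℕ} (reg : QCDRegularisation Nf) (m : Fin Nf → ℝ) (s δ C : ℝ) : Prop :=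
  0 < s ∧ s < 1 ∧ 0 < δ ∧ ∀ᶠ k in atTop, ∀ S : ℕ, reg.L k ≤ S → ∀ (f : Fin Nf) (v : Site 4),
    v ∈ box 4 S → fmMoment reg m s k S f v ≤ C * Real.exp (-(δ * (reg.a k * ‖v‖)))

/-- **First lemma (AlmostSureQuarkLocality).** Clause (ii) — an AVERAGED fractional-moment bound,
pair by pair — upgrades by summation (Markov/Borel–Cantelli bookkeeping, `∑_{v ∈ ℤ⁴} (1+‖v‖)^{-5} < ∞`)
to a bound on the weighted sum over ALL endpoints, uniformly in `k` and in the volume: the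
configuration-wise form "`(Σ|G_f(0,v)|)^s ≤ A_k(U)·(1+‖v‖)^5 e^{-δ a_k ‖v‖/2}` with `E_{|w|}[A_k] ≤ C'`"
that a block-scale (Schur / domain-decomposition) integration of the quarks consumes.  The polynomial
`(1+‖v‖)^5` in LATTICE units is the honest entropy price: it is what forces the block scale of the
graft to carry the sharp `a_k^{3s}` normalisation from the fermionic UV flow (card, § Barriers). -/
theorem almostSureQuarkLocality {Nf : ℕ} (reg : QCDRegularisation Nf) (m : Fin Nf → ℝ)
    (s δ C : ℝ) (h : ClauseII reg m s δ C) :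
    ∃ C' : ℝ, ∀ᶠ k in atTop, ∀ S : ℕ, reg.L k ≤ S → ∀ f : Fin Nf,
      fmWeightedSum reg m s δ k S f ≤ C' := by
  sorry

/-- **Second sketch lemma (SignLocalisationAlongAPath).** The abstract face of "the N_f = 3 sign is a
product of BLOCK signs once the blocks decouple": if `D` (block-diagonal Dirichlet part) and `O`
(inter-block hops) are both `J`-hermitian (`γ₅`-hermiticity, `J = γ₅ ⊗ 1`), so that every
`det (D + t O)`, `t ∈ ℝ`, is real, and the straight path `t ↦ D + tO`, `t ∈ [0,1]`, stays invertible
(block-scale heaviness: e.g. `‖D⁻¹O‖ < 1`, or the nested-dissection separator bound of route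
NestedDissectionSea), then `det (D+O)` and `det D` have the SAME sign — no reweighting is ever needed
in the decoupled regime; `sign det D_W = ∏_B sign det D_BB` is a dilute field of local activities. -/
theorem signLocalisationAlongAPath {n : Type*} [Fintype n] [DecidableEq n]
    (D O J : Matrix n n ℂ) (hJ : IsUnit J)
    (hD : D.conjTranspose = J * D * J⁻¹) (hO : O.conjTranspose = J * O * J⁻¹)
    (hpath : ∀ t : ℝ, 0 ≤ t → t ≤ 1 → (D + (t : ℂ) • O).det ≠ 0) :
    0 < (D.det).re * ((D + O).det).re ∧ (D.det).im = 0 ∧ ((D + O).det).im = 0 := by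
  sorry

/-- **Composition shape (what the card's line must deliver).** The graft never uses clause (iii) or
the phase-quenched flavour decay hypothesis; it consumes the scaling clauses, (i), (ii) and — only as
a factor-2 reweighting licence at the scheme's own volume — (iv).  Typed here as the target
implication with the heavy-threshold body of route HeavyThresholdYMBridge as the intermediate:
`ThresholdQCD → GluonicCompletion` is immediate (the conclusion `QCDOf N_f` of `GluonicCompletion`
does not mention the hypothesis' regularisation), which is WHY the card's content is the converse
bookkeeping: H's regularisation, shifted by the threshold, is the witness the bridge needs. -/
theorem gluonicCompletion_of_thresholdQCD
    (hT : Summit.QuantumFields.QCD.Theses.HeavyThresholdYMBridge.ThresholdQCD)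
    (hS : Summit.QuantumFields.QCD.Theses.HeavyThresholdYMBridge.ThresholdShift) :
    Summit.QuantumFields.QCD.Theses.PauliWegnerSea.GluonicCompletion := by
  intro Nf hNf _
  obtain ⟨M₀, hM₀, reg, hms, hbody⟩ := hT Nf hNf
  obtain ⟨reg', hms', hsch⟩ := hS Nf reg M₀
  refine ⟨reg', hms' hms, fun m hm => ?_⟩
  obtain ⟨z, shift, T, hq, h1, h2, h3, Δ, hΔ, hg, hl⟩ :=
    hbody (fun f => m f + M₀) (fun f => by linarith [hm f])
  refine ⟨z, shift, T, ?_, h1, h2, h3, Δ, hΔ, hg, ?_⟩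
  · rw [hsch]; exact hq
  · rw [hsch]; exact hl

end

end Summit.QuantumFields.QCD.Cruxes.GluonicCompletion.CertifiedSeaThresholdGraft
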